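import Literature.Geometry.Kaehler.CechDeRhamTransgression
import Literature.Geometry.Kaehler.ManifoldFormsPullback
import HarnessLib

/-!
# Transgressions pull back along smooth maps

Functoriality of the Čech–de Rham zig-zag: if `f : N → M` is a `C^∞` map and `θ` is reached from
the Čech cochain of forms `w` on the open cover `𝔘 = (U_i)` of `M` by a zig-zag `Z`
(`IsTransgression hU q w θ`), then `f^*θ` is reached from `f^*w` on the cover `f⁻¹𝔘` of `N` by
the pulled-back zig-zag `f^*Z` — pull-back commutes with restriction to the `f⁻¹(U_J)`, with the
Čech differential, and (pointwise, at the points where the cochains are smooth) with `d`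
(`mextDeriv_pullback_apply`, Warner Prop. 2.23). This is the analytic half of "symbol classes pull
back along holomorphic maps" (units pull back), used by every transport of symbol cocycles between Hodge models
(e.g. `[m]^*` on abelian varieties).

* `IsTransgression.of_eqOn_top` — the relation only sees the values of `w_J` on `U_J`;
* `cechSet_preimage`, `pullback_apply_congr`, `pullback_sum_smul_apply` — bookkeeping;
* `IsTransgression.comap` — **`IsTransgression hU q w θ → IsTransgression (f⁻¹hU) q (f^*w) (f^*θ)`**
  for `f` real `C^∞`.

References: R. Bott, L. W. Tu, *Differential Forms in Algebraic Topology* (1982), §8 (8.4),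
Prop. 8.8, and §I.2 (functoriality of the de Rham complex); F. W. Warner, *Foundations of
Differentiable Manifolds and Lie Groups* (1983), 2.22–2.23.

Provenance: Literature home (namespace `Literature.Geometry.Kaehler.CechDeRham`) of the Summits-side `Theorems/MilnorKExponentialSymbolLiftRTransgressionPullback` (route `MilnorKExponential` of the Hodge summit, crux `SymbolLiftR`; all its imports are `Literature/` and Mathlib); theorems only, no named fact, no definition; the route's packaged `stub_…` statement is kept under a `…_closed` name, and the two dot-notation lemmas are renamed `IsTransgression.of_eqOn_top` ∕ `IsTransgression.comap` (their Summits-side names `congr_top` ∕ `pullback` stay with the Summits file). Lane `lit-hodgefound` (Layer A1: Čech–de Rham calculus, Milnor symbols and symbol classes), seat p20.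
-/

noncomputable section

open scoped Manifold _root_.Topology ContDiff
open Set Function Filter

namespace Literature.Geometry.Kaehler.CechDeRham

open Literature.Geometry.Kaehler

variable {E : Type*} [NormedAddCommGroup E] [NormedSpace ℝ E]
  {H : Type*} [TopologicalSpace H] {I : ModelWithCorners ℝ E H}
  {M : Type*} [TopologicalSpace M] [ChartedSpace H M]
  {E' : Type*} [NormedAddCommGroup E'] [NormedSpace ℝ E']
  {H' : Type*} [TopologicalSpace H'] {I' : ModelWithCorners ℝ E' H'}
  {N : Type*} [TopologicalSpace N] [ChartedSpace H' N]
  {F : Type*} [NormedAddCommGroup F] [NormedSpace ℝ F]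
  {ι : Type*} {U : ι → Set M} {hU : ∀ i, IsOpen (U i)} {q k : ℕ}

/-! ### Bookkeeping -/

omit [TopologicalSpace M] [TopologicalSpace N] in
/-- The finite intersections of the pulled-back cover are the preimages of the finite
intersections. [cite: BottTu1982Forms, §8 Prop. 8.8] -/
theorem cechSet_preimage (f : N → M) {n : ℕ} (J : Fin n → ι) :
    cechSet (fun i ↦ f ⁻¹' U i) J = f ⁻¹' cechSet U J := by
  ext y
  simp only [mem_cechSet_iff, mem_preimage]

/-- Two forms with the same value at `f y` have the same pull-back at `y`. [cite: BottTu1982Forms, §8 Prop. 8.8] -/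
theorem pullback_apply_congr (f : N → M) {α β : MForm I M F k} {y : N} (h : α (f y) = β (f y)) :
    α.pullback I' f y = β.pullback I' f y := by
  ext v
  rw [MForm.pullback_apply, MForm.pullback_apply, h]

/-- Pull-back commutes with signed finite sums, pointwise. [cite: BottTu1982Forms, §8 Prop. 8.8] -/
theorem pullback_sum_smul_apply (f : N → M) {β : Type*} (s : Finset β) (c : β → ℝ)
    (α : β → MForm I M F k) (y : N) :
    (∑ b ∈ s, c b • α b).pullback I' f y = ∑ b ∈ s, c b • (α b).pullback I' f y := by
  have h : (∑ b ∈ s, c b • α b).pullback I' f = ∑ b ∈ s, c b • (α b).pullback I' f := by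
    rw [← MForm.pullbackₗ_apply, map_sum]
    exact Finset.sum_congr rfl fun b _ ↦ by rw [map_smul, MForm.pullbackₗ_apply]
  rw [h, Finset.sum_apply]
  rfl

variable [IsManifold I ∞ M]

/-- **The transgression relation only sees `w_J` on `U_J`**: a zig-zag from `w` is a zig-zag from
any `w'` agreeing with `w` at the points of the `U_J`. [cite: BottTu1982Forms, §8 Prop. 8.8] -/
theorem _root_.Literature.Geometry.Kaehler.IsTransgression.of_eqOn_top
    {w w' : (Fin (q + 2) → ι) → MForm I M F (q + 1)} {θ : MForm I M F (2 * q + 1 + 1)}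
    (h : IsTransgression hU q w θ) (hw : ∀ J, ∀ x ∈ cechSet U J, w J x = w' J x) :
    IsTransgression hU q w' θ := by
  obtain ⟨Z, htop, hsteps, hbot⟩ := h
  exact ⟨Z, fun J x hx ↦ (htop J x hx).trans (hw J x hx), hsteps, hbot⟩

/-! ### Pull-back of a zig-zag -/

variable [IsManifold I' ∞ N]

/-- The pull-back of a form on `U_J` along a `C^∞` map is a form on `f⁻¹(U_J)` (smooth at its
points by `MForm.SmoothAt.pullback`, zero off it). [cite: Warner1983, 2.22] -/
theorem pullback_mem_smoothFormsOn_preimage {f : N → M} (hf : ContMDiff I' I ∞ f) {n : ℕ}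
    (J : Fin n → ι) (α : smoothFormsOn I F (cechSet U J) k) :
    (α : MForm I M F k).pullback I' f ∈ smoothFormsOn I' F (cechSet (fun i ↦ f ⁻¹' U i) J) k := by
  rw [cechSet_preimage]
  refine ⟨fun y hy ↦ MForm.SmoothAt.pullback (Eventually.of_forall fun z ↦ hf z) (α.2.1 (f y) hy),
    fun y hy ↦ ?_⟩
  ext v
  rw [MForm.pullback_apply, α.2.2 (f y) hy]
  rfl

/-- **Transgressions pull back along `C^∞` maps.** If `θ` is reached from the Čech cochain of
forms `w` on the open cover `𝔘` of `M` by a Čech–de Rham zig-zag, and `f : N → M` is real `C^∞`,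
then `f^*θ` is reached from `(f^*w_J)_J` on the cover `f⁻¹𝔘` of `N` (by the pulled-back zig-zag
`(f^*Z_{a,b})`: pull-back commutes with the Čech differential and, at the points of `f⁻¹(U_J)`
where the cochains are smooth, with `d`, Warner Prop. 2.23). [cite: BottTu1982Forms, §8 Prop. 8.8] -/
theorem _root_.Literature.Geometry.Kaehler.IsTransgression.comap {f : N → M}
    (hf : ContMDiff I' I ∞ f) {w : (Fin (q + 2) → ι) → MForm I M F (q + 1)}
    {θ : MForm I M F (2 * q + 1 + 1)} (h : IsTransgression hU q w θ) :
    IsTransgression (U := fun i ↦ f ⁻¹' U i) (fun i ↦ (hU i).preimage hf.continuous) q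
      (fun J ↦ (w J).pullback I' f) (θ.pullback I' f) := by
  obtain ⟨Z, htop, hsteps, hbot⟩ := h
  set hU' : ∀ i, IsOpen (f ⁻¹' U i) := fun i ↦ (hU i).preimage hf.continuous with hU'def
  -- the pulled-back zig-zag
  set Z' : (a b : ℕ) → CechForms I' F (fun i ↦ f ⁻¹' U i) a b :=
    fun a b J ↦ ⟨(Z a b J : MForm I M F b).pullback I' f, pullback_mem_smoothFormsOn_preimage hf J _⟩
    with hZ'
  have hZ'J : ∀ a b J, (Z' a b J : MForm I' N F b) = (Z a b J : MForm I M F b).pullback I' f :=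
    fun _ _ _ ↦ rfl
  have hfev : ∀ y : N, ∀ᶠ z in 𝓝 y, ContMDiffAt I' I ∞ f z := fun y ↦ Eventually.of_forall fun z ↦ hf z
  -- the Čech differential of the pulled-back cochain, at a point of `f⁻¹(U_J)`
  have hδ : ∀ (a b : ℕ) (J : Fin (a + 2) → ι) (y : N), y ∈ cechSet (fun i ↦ f ⁻¹' U i) J →
      (cechδ I' F hU' a b (Z' a b) J : MForm I' N F b) y =
        (cechδ I F hU a b (Z a b) J : MForm I M F b).pullback I' f y := by
    intro a b J y hy
    have hfy : f y ∈ cechSet U J := by rwa [cechSet_preimage] at hy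
    rw [coe_cechδ_apply_apply_of_mem hU' _ hy]
    have h1 : (∑ j : Fin (a + 2), (-1 : ℝ) ^ (j : ℕ) •
        (Z a b (J ∘ Fin.succAbove j) : MForm I M F b)).pullback I' f y =
          (cechδ I F hU a b (Z a b) J : MForm I M F b).pullback I' f y :=
      pullback_apply_congr f (by rw [coe_cechδ_apply_apply_of_mem hU _ hfy, Finset.sum_apply]; rfl)
    rw [← h1, pullback_sum_smul_apply]
  refine ⟨Z', fun J y hy ↦ ?_, fun a b hab hlt ↦ ?_, fun J y hy ↦ ?_⟩
  · -- top
    have hfy : f y ∈ cechSet U J := by rwa [cechSet_preimage] at hy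
    rw [hδ q (q + 1) J y hy]
    exact pullback_apply_congr f (htop J (f y) hfy)
  · -- steps
    funext J
    apply Subtype.ext
    funext y
    by_cases hy : y ∈ cechSet (fun i ↦ f ⁻¹' U i) J
    · have hfy : f y ∈ cechSet U J := by rwa [cechSet_preimage] at hy
      have hstep := congrArg (fun c : CechForms I F U (a + 1) (b + 1) ↦ (c J : MForm I M F (b + 1)) (f y))
        (hsteps a b hab hlt)
      rw [cechd_apply, Submodule.coe_smul, Pi.smul_apply, localD_apply_of_mem _ _ hfy] at hstep
      rw [hδ a (b + 1) J y hy, cechd_apply, Submodule.coe_smul, Pi.smul_apply,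
        localD_apply_of_mem _ _ hy, hZ'J,
        mextDeriv_pullback_apply (hfev y) ((Z (a + 1) b J).2.1 (f y) hfy)]
      have h2 : ((-1 : ℝ) ^ (a + 1) • mextDeriv (Z (a + 1) b J : MForm I M F b)).pullback I' f y =
          (cechδ I F hU a (b + 1) (Z a (b + 1)) J : MForm I M F (b + 1)).pullback I' f y :=
        pullback_apply_congr f (by rw [Pi.smul_apply]; exact hstep)
      rw [← h2, MForm.pullback_smul, Pi.smul_apply]
    · rw [(cechd I' F hU' (a + 1) b (Z' (a + 1) b) J).2.2 y hy,
        (cechδ I' F hU' a (b + 1) (Z' a (b + 1)) J).2.2 y hy]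
  · -- bottom
    have hfy : f y ∈ cechSet U J := by rwa [cechSet_preimage] at hy
    have hb := hbot J (f y) hfy
    rw [cechd_apply, Submodule.coe_smul, Pi.smul_apply, localD_apply_of_mem _ _ hfy, pow_zero,
      one_smul] at hb
    rw [cechd_apply, Submodule.coe_smul, Pi.smul_apply, localD_apply_of_mem _ _ hy, pow_zero,
      one_smul, hZ'J, mextDeriv_pullback_apply (hfev y) ((Z 0 (2 * q + 1) J).2.1 (f y) hfy)]
    exact pullback_apply_congr f hb

/-- Packaged (closed) form `isTransgression_pullback_closed`: `IsTransgression.comap`, stated closed.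
[cite: BottTu1982Forms, §8 Prop. 8.8] -/
theorem isTransgression_pullback_closed : ∀ {E : Type*} [NormedAddCommGroup E] [NormedSpace ℝ E] {H : Type*} [TopologicalSpace H] {I : ModelWithCorners ℝ E H} {M : Type*} [TopologicalSpace M] [ChartedSpace H M] {E' : Type*} [NormedAddCommGroup E'] [NormedSpace ℝ E'] {H' : Type*} [TopologicalSpace H'] {I' : ModelWithCorners ℝ E' H'} {N : Type*} [TopologicalSpace N] [ChartedSpace H' N] {F : Type*} [NormedAddCommGroup F] [NormedSpace ℝ F] {ι : Type*} {U : ι → Set M} {hU : ∀ i, IsOpen (U i)} {q : ℕ} [IsManifold I ∞ M] [IsManifold I' ∞ N] {f : N → M} (hf : ContMDiff I' I ∞ f) {w : (Fin (q + 2) → ι) → MForm I M F (q + 1)} {θ : MForm I M F (2 * q + 1 + 1)}, IsTransgression hU q w θ → IsTransgression (U := fun i ↦ f ⁻¹' U i) (fun i ↦ (hU i).preimage hf.continuous) q (fun J ↦ (w J).pullback I' f) (θ.pullback I' f) :=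
  fun hf _ _ h ↦ h.comap hf

end Literature.Geometry.Kaehler.CechDeRham

end
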